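import Literature.AlgebraicGeometry.HodgeTheory.HardLefschetzNFoldHolds
import Literature.AlgebraicGeometry.HodgeTheory.PgZeroSurfaceFamilyFiniteMonodromy
import Literature.AlgebraicGeometry.HodgeTheory.HyperplaneClassRational
import Literature.AlgebraicGeometry.HodgeTheory.KaehlerClass
import Literature.AlgebraicGeometry.Motives.SegreHyperplaneClass
import Literature.AlgebraicGeometry.Motives.SegreEmbedding
import Literature.AlgebraicGeometry.Motives.AbelianVarietyProduct
import Literature.AlgebraicGeometry.Motives.AbelianVarietyProjectiveChart
import Literature.AlgebraicGeometry.Motives.AbelianVarietyProductDimProofs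
import HarnessLib

/-!
# Ring 2 · AbelianAll · SPREADING axis, part XVIII — THE BOX HARD-LEFSCHETZ DATUM ON `A × B` (request R1′ of part XVII,
# DISCHARGED BY ASSEMBLY): a hard-Lefschetz datum of `A × B` whose class is a non-zero multiple of `fst^* h_A + snd^* h_B`

research route, not a corollary; conditional on HC_CM plus one named minimal statement.

Family `hodge`, AbelianAll sub-cell of ring 2, SPREADING axis (`pub-hodge-ring2-ab-spread-1`). Part XVII
(`Ring2AbelianAllSpreadFloorCollapse`) showed that the three anchored floor nodes `F_CM`, `F_CM^prim`, `F_CM^{prim,ev}` are one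
statement modulo the displayed primitive-lift shape `(PL)`, and recorded two requests towards typing `(PL)`: R1′ — a hard-Lefschetz
datum on the product `A × B` whose hyperplane class is (a non-zero multiple of) the BOX class `fst^* h_A + snd^* h_B`, `h_A`, `h_B`
themselves (multiples of) classes of hard-Lefschetz data on the factors — and R2′ — the `𝔰𝔩₂`-equivariance of Künneth for that class
plus the Clebsch–Gordan lift (= `(PL)`). Rev. 3 of part XVII observed that R1′ is an ASSEMBLY of theorems already in the tree, because
the box class is, up to a non-zero scalar, the hyperplane class of the composite Segre embedding
`A × B ⟶ ℙⁿ × ℙᵐ ⟶ ℙ^{nm+n+m}`. THIS FILE PERFORMS THAT ASSEMBLY (no new Hodge theory, no definition, no named fact, no sorry):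

* `exists_hardLefschetzNFold_eq_smul_map` — for a smooth projective `X` of dimension `n ≥ 1`, a closed immersion
  `ι : X ⟶ ℙᴺ` and a non-zero rational class `g ∈ H²(ℙᴺ(ℂ); ℂ)`: a hard-Lefschetz datum `Λ` of `X` and `t ≠ 0` with
  `Λ.hyperplaneClass = t • ι^* g` (`exists_fubiniStudy_eq_smul_map`: the Fubini–Study class `H = μ • ι^* ρ`;
  `exists_pos_smul_isRationalClass_of_pullback_eq_fubiniStudy` + `HodgeModel.exists_hardLefschetzNFold_of_pullback_eq_fubiniStudy_smul`:
  a datum of class `r • H`; `H ≠ 0` because it is a Kähler class (`IsKaehlerClassVia.ne_zero`); `H²(ℙᴺ)` is spanned by one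
  rational class (`exists_isRationalClass_forall_eq_smul_projectiveSpace`)).
* `exists_hardLefschetzNFold_prod_box` — **R1′**: for complex abelian varieties `A`, `B` of positive dimension there are RATIONAL
  classes `h_A ∈ H²(A)`, `h_B ∈ H²(B)`, hard-Lefschetz data `Λ_A` of `A` and `Λ_B` of `B` whose classes are non-zero multiples of
  `h_A`, `h_B`, and a hard-Lefschetz datum `Λ` of `A × B` (`(A.prod B).X = A.X ⊗ B.X`, dimension `dim A + dim B`) whose class is a
  non-zero multiple of `fst^* h_A + snd^* h_B` — the Segre embedding of two projective embeddings (`isClosedImmersion_tensorHom_left`,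
  `isClosedImmersion_segreEmbedding_left`) has additive hyperplane class (`exists_segreHyperplaneClasses`), and the lemma above applies
  on `A`, on `B` and on `A × B`.

What this does NOT do: R2′ / `(PL)` — the Leibniz expansion of the powers of `L_{fst^* h_A + snd^* h_B}` on Künneth cross products and
the Clebsch–Gordan lowest-weight computation remain untyped; the rows of part XVII stay modulo `(PL)`; B_min of record is unchanged;
`HC_CM` is not mentioned; no case of the Hodge conjecture is proved. Sources: hard Lefschetz for a hyperplane class, Voisin I Thm. 6.25;
the Segre embedding and `σ^*𝒪(1) = 𝒪(1,1)`, Hartshorne II Ex. 5.11–5.12; the product polarisation `𝓛_X ⊠ 𝓛_Y`, André 1996 §1.3.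
[cite: VoisinHodgeI2002, Thm. 6.25, Rem. 6.27 and §7.1.2] [cite: Hartshorne1977, II Ex. 5.11 and Ex. 5.12]
[cite: Andre1996Motifs, §1.3 (p. 12)]
-/

set_option linter.dupNamespace false

namespace Summit.HodgeConjecture.HodgeConjecture.Ring2.AbelianAll

open scoped Manifold ContDiff
open CategoryTheory AlgebraicGeometry MonoidalCategory
open Literature.AlgebraicGeometry Literature.AlgebraicGeometry.Motives
open Literature.AlgebraicGeometry.HodgeTheory
open Literature.AlgebraicGeometry.Motives.SegreHyperplaneClass
open Literature.AlgebraicTopology.SingularHomology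
open Literature.NumberTheory.Transcendental Literature.Geometry.Kaehler
open Literature.AlgebraicGeometry.Motives.AnalytificationKaehler (fubiniStudyPullbackForm)

/-- **A hard-Lefschetz datum whose class is a non-zero multiple of the pulled-back hyperplane class.** For `X` smooth projective of
dimension `n ≥ 1` over `ℂ`, a closed immersion `ι : X ⟶ ℙᴺ` and a non-zero rational `g ∈ H²(ℙᴺ(ℂ); ℂ)`, there are a hard-Lefschetz
datum `Λ` of `X` and `t ≠ 0` with `Λ.hyperplaneClass = t • ι^* g`. Assembly: the Fubini–Study class `H` of `ι` satisfies
`H = μ • ι^* ρ` with `ρ` rational (`exists_fubiniStudy_eq_smul_map`), some `r • H`, `r > 0`, is rational and is the class of a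
hard-Lefschetz datum (`exists_pos_smul_isRationalClass_of_pullback_eq_fubiniStudy`,
`HodgeModel.exists_hardLefschetzNFold_of_pullback_eq_fubiniStudy_smul`), `H ≠ 0` (a Kähler class, `IsKaehlerClassVia.ne_zero`), and
`ρ`, `g` are multiples of one class spanning `H²(ℙᴺ)` (`exists_isRationalClass_forall_eq_smul_projectiveSpace`).
[cite: VoisinHodgeI2002, Thm. 6.25, Rem. 6.27, §7.1.2 and Thm. 7.10] -/
theorem exists_hardLefschetzNFold_eq_smul_map {n N : ℕ} {X : Motives.SchemeOver ℂ} (hX : IsSmoothProjective n X)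
    (hn : 1 ≤ n) (ι : X ⟶ projectiveSpace N ℂ) [IsClosedImmersion ι.left] {g : complexBetti (projectiveSpace N ℂ) 2}
    (hg0 : g ≠ 0) :
    ∃ (Λ : HardLefschetzNFold n X) (t : ℂ), t ≠ 0 ∧ Λ.hyperplaneClass = t • complexBetti.map ι 2 g := by
  obtain ⟨A, e, he, hem, hθ, H, ρ, μ, hH, -, hHρ⟩ := exists_fubiniStudy_eq_smul_map hX ι
  obtain ⟨r, hr, hrat⟩ := exists_pos_smul_isRationalClass_of_pullback_eq_fubiniStudy hX A ι e he hθ hH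
  have hw : ((r : ℝ) : ℂ) ≠ 0 := by exact_mod_cast hr.ne'
  obtain ⟨Λ, hΛ⟩ := A.exists_hardLefschetzNFold_of_pullback_eq_fubiniStudy_smul ι e hX he hem hθ hH hw hrat
  have hK : A.IsKaehlerClassVia e H := A.isKaehlerClassVia_of_pullback_eq_fubiniStudyPullbackForm e hX ι hθ hH
  have hH0 : H ≠ 0 := hK.ne_zero hX hn
  obtain ⟨r₀, -, hgen⟩ := exists_isRationalClass_forall_eq_smul_projectiveSpace N
  obtain ⟨z₁, hz₁⟩ := hgen ρ
  obtain ⟨z₂, hz₂⟩ := hgen g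
  have hz₂0 : z₂ ≠ 0 := by
    rintro rfl
    exact hg0 (by rw [hz₂, zero_smul])
  have hρg : ρ = (z₁ * z₂⁻¹) • g := by
    rw [hz₂, smul_smul, mul_assoc, inv_mul_cancel₀ hz₂0, mul_one, hz₁]
  have hμ0 : μ * (z₁ * z₂⁻¹) ≠ 0 := by
    intro h0
    apply hH0
    rw [hHρ, hρg, map_smul, smul_smul, h0, zero_smul]
  refine ⟨Λ, (r : ℂ) * (μ * (z₁ * z₂⁻¹)), mul_ne_zero hw hμ0, ?_⟩
  rw [hΛ, hHρ, hρg, map_smul, smul_smul, smul_smul]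
  congr 1
  ring

/-- **R1′ of part XVII — the box hard-Lefschetz datum on a product of abelian varieties.** For complex abelian varieties `A`, `B`
of positive dimension there are rational classes `h_A ∈ H²(A(ℂ); ℂ)`, `h_B ∈ H²(B(ℂ); ℂ)`, hard-Lefschetz data `Λ_A` of `A` and `Λ_B`
of `B` with `Λ_A.hyperplaneClass = a • h_A`, `Λ_B.hyperplaneClass = b • h_B`, `a, b ≠ 0`, and a hard-Lefschetz datum `Λ` of the
product `A × B` (underlying variety `A.X ⊗ B.X`, dimension `dim A + dim B`) with
`Λ.hyperplaneClass = t • (fst^* h_A + snd^* h_B)`, `t ≠ 0`. Assembly: projective embeddings `e_A : A ⟶ ℙⁿ`, `e_B : B ⟶ ℙᵐ`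
(`IsSmoothProjective.isProjectiveOver`), the composite Segre embedding `(e_A ⊗ e_B) ≫ σ : A × B ⟶ ℙ^{nm+n+m}` (a closed immersion:
`isClosedImmersion_tensorHom_left`, `isClosedImmersion_segreEmbedding_left`) with ADDITIVE rational hyperplane class
`σ^* g = fst^* g_n + snd^* g_m` (`exists_segreHyperplaneClasses`), and `exists_hardLefschetzNFold_eq_smul_map` on `A`, `B`, `A × B`
with `h_A := e_A^* g_n`, `h_B := e_B^* g_m`. This is the bijectivity half of "hard Lefschetz for the product polarisation
`𝓛_A ⊠ 𝓛_B`" (André 1996 §1.3); the `𝔰𝔩₂`-equivariance of Künneth for this class (R2′ = `(PL)`) is NOT proved here.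
[cite: VoisinHodgeI2002, Thm. 6.25, Rem. 6.27 and §7.1.2] [cite: Hartshorne1977, II Ex. 5.11 and Ex. 5.12]
[cite: Andre1996Motifs, §1.3 (p. 12)] -/
theorem exists_hardLefschetzNFold_prod_box (A B : AbelianVariety ℂ) (hA : 1 ≤ A.dim) (hB : 1 ≤ B.dim) :
    ∃ (hA' : complexBetti A.X 2) (hB' : complexBetti B.X 2),
      IsRationalClass hA' ∧ IsRationalClass hB' ∧
      (∃ (ΛA : HardLefschetzNFold A.dim A.X) (a : ℂ), a ≠ 0 ∧ ΛA.hyperplaneClass = a • hA') ∧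
      (∃ (ΛB : HardLefschetzNFold B.dim B.X) (b : ℂ), b ≠ 0 ∧ ΛB.hyperplaneClass = b • hB') ∧
      ∃ (Λ : HardLefschetzNFold (A.prod B).dim (A.prod B).X) (t : ℂ), t ≠ 0 ∧
        Λ.hyperplaneClass = t • (complexBetti.map (AbelianVariety.fst A B).hom.hom.hom 2 hA' +
          complexBetti.map (AbelianVariety.snd A B).hom.hom.hom 2 hB') := by
  have hXA : IsSmoothProjective A.dim A.X := AbelianVariety.isSmoothProjective_holds
  have hXB : IsSmoothProjective B.dim B.X := AbelianVariety.isSmoothProjective_holds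
  have hXAB : IsSmoothProjective (A.prod B).dim (A.prod B).X := AbelianVariety.isSmoothProjective_holds
  obtain ⟨nA, eA, hnA, heA⟩ := exists_closedImmersion_projectiveSpace_pos A
  obtain ⟨nB, eB, hnB, heB⟩ := exists_closedImmersion_projectiveSpace_pos B
  haveI := heA
  haveI := heB
  obtain ⟨g, hgrat, hg0, hsegre⟩ := exists_segreHyperplaneClasses
  have hM : 1 ≤ nA * nB + nA + nB := le_trans hnB (Nat.le_add_left _ _)
  -- the composite Segre embedding of `A × B`
  obtain ⟨κ, hκ⟩ : ∃ κ : A.X ⊗ B.X ⟶ projectiveSpace (nA * nB + nA + nB) ℂ,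
      κ = (eA ⊗ₘ eB) ≫ segreEmbedding nA nB ℂ := ⟨_, rfl⟩
  haveI := isClosedImmersion_tensorHom_left (X := A.X) (Y := B.X) eA eB
  haveI hκci : IsClosedImmersion κ.left := by
    rw [hκ]
    change IsClosedImmersion ((eA ⊗ₘ eB).left ≫ (segreEmbedding nA nB ℂ).left)
    infer_instance
  have hdim : 1 ≤ (A.prod B).dim := by rw [AbelianVariety.dim_prod]; omega
  obtain ⟨ΛA, a, ha, hΛA⟩ := exists_hardLefschetzNFold_eq_smul_map hXA hA eA (hg0 nA hnA)
  obtain ⟨ΛB, b, hb, hΛB⟩ := exists_hardLefschetzNFold_eq_smul_map hXB hB eB (hg0 nB hnB)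
  obtain ⟨Λ, t, ht, hΛ⟩ := exists_hardLefschetzNFold_eq_smul_map (X := A.X ⊗ B.X) hXAB hdim κ (hg0 _ hM)
  -- `κ^* g = (e_A ⊗ e_B)^* σ^* g = fst^* e_A^* g_n + snd^* e_B^* g_m`
  have final : complexBetti.map κ 2 (g (nA * nB + nA + nB)) =
      complexBetti.map (CartesianMonoidalCategory.fst A.X B.X) 2 (complexBetti.map eA 2 (g nA)) +
        complexBetti.map (CartesianMonoidalCategory.snd A.X B.X) 2 (complexBetti.map eB 2 (g nB)) := by
    rw [hκ, map_comp_apply', hsegre, map_add, map_tensorHom_map_fst, map_tensorHom_map_snd]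
  refine ⟨complexBetti.map eA 2 (g nA), complexBetti.map eB 2 (g nB),
    (hgrat nA).pullback (AlgPoints.mapContinuous (L := ℂ) eA), (hgrat nB).pullback (AlgPoints.mapContinuous (L := ℂ) eB),
    ⟨ΛA, a, ha, hΛA⟩, ⟨ΛB, b, hb, hΛB⟩, Λ, t, ht, ?_⟩
  rw [hΛ, final]
  rfl

end Summit.HodgeConjecture.HodgeConjecture.Ring2.AbelianAll
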